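import Summits.QuantumFields.YangMills.Theses.ParabolicTrajectory
import Literature.MathematicalPhysics.QuantumFieldTheory.BalabanRegulatorChart
import Summits.QuantumFields.YangMills.Theorems.ParabolicTrajectoryBalabanStepParabolicStubParabolicBlock
import Summits.QuantumFields.YangMills.Theorems.ParabolicTrajectoryBalabanStepParabolicStubRealisation
import Summits.QuantumFields.YangMills.Theorems.BalabanStepParabolic.Negative.EvenRedundant

/-!
# Crux `BalabanStepParabolic` (stmt-QuantumFields-9684) via the line `perfect-action-regulator-chart` — skeleton v5

Route `ParabolicTrajectory` of `YangMills`; crux (concluded BY NAME below):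
`Summit.QuantumFields.YangMills.Theses.ParabolicTrajectory.BalabanStepParabolic` =
`∀ G (compact simple Lie) r, ∃ M₀, ∀ M ≥ M₀, Nonempty (BalabanBanachStep G r M)`.

The line (lead `prover-line-stmt-QuantumFields-9684-0`, `PICKED.md` in the crux directory): realise one complete
block-averaging step as a `C¹` map of a fixed Banach chart centred at the perfect action with the large-field
regulator in the norm — the Literature hypothesis structure `RegulatorChart G r M`
(`Literature/MathematicalPhysics/QuantumFieldTheory/BalabanRegulatorChart.lean`, p71493: chart predicates
`ParabolicBlock`, `BasinBlock`, normal form `SmoothHalfChart`, observable side `ChartRealisationData`).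

STATUS v5. Of the three stubs registered with v1–v3, two are LANDED and imported:
`stub_parabolicBlock` (smooth half-chart ⇒ verbatim Lipschitz/basin blocks for the odd/even extension;
`…Theorems.ParabolicTrajectoryBalabanStepParabolicStubParabolicBlock`, p72091) and `stub_realisation` (parabolic
block + basin block + chart realisation data ⇒ `BalabanBanachStep G r M`, by injectivising the step on
`E × (ℝ × E)` and killing non-curvature species; `…StubRealisation`, p71974). RESHAPE (v4 → v5): the remaining
load-bearing stub is restricted to ODD block factors — `stub_regulatorChartOdd` — because even `M` carry no
renormalisation-group content for either object: `Negative.nonempty_of_even` (EvenRedundant.lean, p71802: the thin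
chart inhabits `BalabanBanachStep G r M` for every even `M ≥ 2`) closes the even half of the crux inside the
composition below, and the same thin chart inhabits `RegulatorChart G r M` for even `M`
(`nonempty_regulatorChart_of_even`, companion file `…RegulatorChartEven`). What is left is exactly the contentful
statement: for odd `M`, `corr_continuousOn` at accumulation points of Wilson orbits is a continuum-type limit of
genuine block-dilated Wilson plaquette correlators along the inhabitant's tuning (`Negative/OrbitTransport.lean`).

* `stub_regulatorChartOdd` (hardest, XL — the analytic core; held by the lead; crux-sized):
  `∀ G (compact simple Lie) r, ∃ M₀, ∀ M ≥ M₀, Odd M → Nonempty (RegulatorChart G r M)`.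
* `BalabanStepParabolic_proof`: `M₀' = max M₀ 2`; even `M` by `Negative.nonempty_of_even`; odd `M` by the chart,
  `stub_parabolicBlock`, `ChartRealisationData.congr`, `stub_realisation` (the only theorem concluding the crux;
  the only `sorry` is inside `stub_regulatorChartOdd`).
-/

open scoped SchwartzMap
open MeasureTheory Filter Topology
open Literature.MathematicalPhysics.AQFT Literature.MathematicalPhysics.QuantumLattice
open Literature.Probability.LatticeModels
open Literature.MathematicalPhysics.QuantumFieldTheory

noncomputable section

namespace Summit.QuantumFields.YangMills.Theorems.BalabanStepParabolic

/-! ### The registered stub (statement in full) -/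

/-- **Stub (hardest, XL — the analytic core of the line, odd block factors).** For every compact simple Lie `G`,
lattice representation `r` and ODD block factor `M ≥ M₀(G, r)`, the perfect-action regulator chart is inhabited.
Internal plan L1–L6 in the line card (Gaussian perfect fixed point and its linearisation; regulator regeneration
with o(g_j²)-summable loss; polymer representation of the exact step as a `C¹` self-map of ONE space; marginal
extraction; Wilson's action in the basin down to `g = 0`; observable slaving ⇒ chart continuity = the crux content
for odd `M`). [folklore] -/
theorem stub_regulatorChartOdd :
    ∀ (G : Type) [Group G] [TopologicalSpace G] [IsTopologicalGroup G] [CompactSpace G],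
      IsCompactSimpleLieGroup G →
      letI : MeasurableSpace G := borel G
      haveI : BorelSpace G := ⟨rfl⟩
      ∀ (r : LatticeRep G), ∃ M₀ : ℕ, ∀ M : ℕ, M₀ ≤ M → Odd M → Nonempty (RegulatorChart G r M) := by
  sorry

/-! ### The kernel-checked composition -/

/-- **The crux from the registered stub and the landed stubs** (the deciding theorem; its type is literally the
route decl; the only `sorry` is inside `stub_regulatorChartOdd`). Take `M₀' = max M₀ 2`. Even `M`: the thin
chart of `Negative.nonempty_of_even`. Odd `M`: from `RegulatorChart G r M` take the smooth half-chart data, extend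
it by `stub_parabolicBlock` to maps `(φ', Ψ')` on `|g| ≤ δ` with the verbatim blocks, transport the realisation
data along the agreement on `g ≥ 0` (`ChartRealisationData.congr`), and conclude with `stub_realisation`. [folklore] -/
theorem BalabanStepParabolic_proof :
    Summit.QuantumFields.YangMills.Theses.ParabolicTrajectory.BalabanStepParabolic := by
  intro G _ _ _ _ hG
  letI : MeasurableSpace G := borel G
  haveI : BorelSpace G := ⟨rfl⟩
  intro r
  obtain ⟨M₀, hM₀⟩ := stub_regulatorChartOdd G hG r
  refine ⟨max M₀ 2, fun M hM => ?_⟩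
  have h2 : 2 ≤ M := (le_max_right _ _).trans hM
  rcases Nat.even_or_odd M with he | ho
  · exact Negative.nonempty_of_even r M h2 he
  · obtain ⟨𝒞⟩ := hM₀ M ((le_max_left _ _).trans hM) ho
    have hs := 𝒞.smooth
    obtain ⟨φ', Ψ', C', hC', hagree, hPB, hBB⟩ :=
      stub_parabolicBlock 𝒞.E 𝒞.φ 𝒞.Ψ 𝒞.A 𝒞.φg 𝒞.φy 𝒞.Ψg 𝒞.Ψy (𝒞.b₀ * Real.log M) 𝒞.C 𝒞.δ 𝒞.R 𝒞.θ' hs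
    exact stub_realisation G r M 𝒞.E φ' Ψ' 𝒞.A 𝒞.b₀ 𝒞.θ C' 𝒞.δ 𝒞.R 𝒞.θ' 𝒞.two_le_M 𝒞.b₀_pos 𝒞.θ_nonneg
      𝒞.θ_lt_one 𝒞.norm_A_le hC' hs.δ_pos hs.δ_le_R hs.θ'_nonneg 𝒞.θ'_lt_one hPB hBB 𝒞.yW 𝒞.g₀
      𝒞.betaOf 𝒞.κ 𝒞.K 𝒞.corr (𝒞.realisation.congr hagree)

end Summit.QuantumFields.YangMills.Theorems.BalabanStepParabolic

end
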